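import Mathlib
import HarnessLib

/-!
# Moments of a finite measure carried by `[0,1]`: monotonicity, and support versus geometric decay

Topic `Literature/MeasureTheory/Moments`.  Elementary (folklore) facts about the power moments
`m_j = ∫ t^j dτ` of a finite positive Borel measure `τ` on `ℝ` carried by `[0,1]`
(`τ [0,1]ᶜ = 0`; a Hausdorff moment sequence), all PROVED here from Mathlib:

* `m_j` is well defined (integrable), nonnegative and nonincreasing in `j`;
* SUPPORT ⇒ RATIO: if `τ (θ, ∞) = 0` then `m_{j+1} ≤ θ · m_j` for every `j`;
* Chebyshev lower bound `θ'^j · τ [θ', ∞) ≤ m_j` (`θ' ≥ 0`);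
* DECAY ⇒ SUPPORT (rigidity): if `m_j ≤ C θ^j` for all `j` with SOME constant `C` (`θ ≥ 0`), then
  `τ (θ, ∞) = 0` — a set `[θ', ∞)`, `θ' > θ`, of positive mass would contribute `θ'^j τ[θ', ∞)`,
  which beats `C θ^j` for large `j`; this is the easy half of `lim m_j^{1/j} = max supp τ`
  (`= ‖t‖_{L^∞(τ)}`);
* consequently, for a sequence `s (n) = ∫ t^{n-1} dτ` (`n ≥ 1`), the CONSTANT-FREE ratio bound
  `s (n+1) ≤ θ · s (n)` (`n ≥ 1`), the geometric decay `s (n) ≤ C θ^n` with some constant, and the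
  support condition `τ (θ, ∞) = 0` are all equivalent (`hausdorffSeq_*`, `seq_le_mul_pow_of_succ_le_mul`);
  the decay is needed only EVENTUALLY and only at every rate `θ' > θ` (limsup form,
  `hausdorffSeq_succ_le_mul_of_forall_gt_eventually_le`).

Reading in statistical mechanics (why it is here): when `s` is a transfer-matrix two-point sequence
`s (n) = ⟨v, Tⁿ⁻¹ v⟩ = ∫ λ^{n-1} dτ_v(λ)` (`0 ≤ T ≤ 1`), `τ (e^{-m}, 1] = 0` is a MASS GAP `≥ m` for the
vector `v`, and the lemmas say: gap `m` ⇔ `s (n+1) ≤ e^{-m} s (n)` for all `n` ⇔ `s (n) = O(e^{-mn})`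
(Glimm–Jaffe, *Quantum Physics*, §6.1; used by route `PrecisionLaplacian` of
`CriticalPhenomena/Ising3DConformalLimit`, crux `DirectCorrelationStableTail`, stub
`stub_linearTransverseGap`, and of the same shape as the support hypotheses `ν (Set.Ioi a) = 0` in
`Summit.QuantumFields.YangMills.Theses.DualityDefect`).

Sources: D. V. Widder, *The Laplace Transform* (1941), Ch. III §§1–4 (Hausdorff moment sequences);
J. A. Shohat, J. D. Tamarkin, *The Problem of Moments* (1943), Ch. I; the `L^p → L^∞` norm limit.
Mathlib has the ingredients (`MeasureTheory.integral_mono_ae`, `setIntegral_const`,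
`tendsto_pow_atTop_nhds_zero_of_lt_one`, `measure_iUnion_null_iff`) but no statement about moment
sequences of measures on `[0,1]` (searched `moment`, `Hausdorff moment`, `completely monotone`:
`Mathlib.Probability.Moments.*` concerns mgf/cgf of random variables only).  No definitions.
-/

namespace Literature.MeasureTheory.Moments

open _root_.MeasureTheory _root_.Filter _root_.Topology
open scoped BigOperators

/-! ## Moments of a finite measure carried by `[0,1]` -/

/-- A measure with `τ [0,1]ᶜ = 0` is carried by `[0,1]`: `τ`-a.e. point lies in `[0,1]`. [folklore] -/
theorem ae_mem_Icc_of_measure_compl_Icc_eq_zero (τ : Measure ℝ)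
    (h : τ (Set.Icc (0 : ℝ) 1)ᶜ = 0) : ∀ᵐ t ∂τ, t ∈ Set.Icc (0 : ℝ) 1 :=
  mem_ae_iff.2 h

/-- Monomials are integrable against a finite measure carried by `[0,1]`. [folklore] -/
theorem integrable_pow_of_measure_compl_Icc_eq_zero (τ : Measure ℝ) [IsFiniteMeasure τ]
    (h : τ (Set.Icc (0 : ℝ) 1)ᶜ = 0) (j : ℕ) : Integrable (fun t : ℝ => t ^ j) τ := by
  refine Integrable.of_bound (continuous_pow j).aestronglyMeasurable 1 ?_
  filter_upwards [ae_mem_Icc_of_measure_compl_Icc_eq_zero τ h] with t ht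
  rw [Real.norm_eq_abs, abs_pow]
  exact pow_le_one₀ (abs_nonneg t) (abs_le.2 ⟨by linarith [ht.1], ht.2⟩)

/-- Moments of a finite measure carried by `[0,1]` are nonnegative. [folklore] -/
theorem integral_pow_nonneg_of_measure_compl_Icc_eq_zero (τ : Measure ℝ)
    (h : τ (Set.Icc (0 : ℝ) 1)ᶜ = 0) (j : ℕ) : 0 ≤ ∫ t, t ^ j ∂τ := by
  refine integral_nonneg_of_ae ?_
  filter_upwards [ae_mem_Icc_of_measure_compl_Icc_eq_zero τ h] with t ht
  exact pow_nonneg ht.1 j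

/-- **Moments of a finite measure carried by `[0,1]` are nonincreasing**: `∫ t^{j+1} dτ ≤ ∫ t^j dτ`. [folklore] -/
theorem integral_pow_succ_le_integral_pow (τ : Measure ℝ) [IsFiniteMeasure τ]
    (h : τ (Set.Icc (0 : ℝ) 1)ᶜ = 0) (j : ℕ) : ∫ t, t ^ (j + 1) ∂τ ≤ ∫ t, t ^ j ∂τ := by
  refine integral_mono_ae (integrable_pow_of_measure_compl_Icc_eq_zero τ h (j + 1))
    (integrable_pow_of_measure_compl_Icc_eq_zero τ h j) ?_
  filter_upwards [ae_mem_Icc_of_measure_compl_Icc_eq_zero τ h] with t ht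
  exact pow_le_pow_of_le_one ht.1 ht.2 (Nat.le_succ j)

/-- **Support ⇒ ratio.**  If a finite measure carried by `[0,1]` gives no mass to `(θ, ∞)`,
then `∫ t^{j+1} dτ ≤ θ · ∫ t^j dτ` (no sign condition on `θ` is needed: if `θ < 0` then `τ = 0`). [folklore] -/
theorem integral_pow_succ_le_mul_integral_pow_of_measure_Ioi_eq_zero (τ : Measure ℝ)
    [IsFiniteMeasure τ] (h : τ (Set.Icc (0 : ℝ) 1)ᶜ = 0) (θ : ℝ)
    (hsupp : τ (Set.Ioi θ) = 0) (j : ℕ) : ∫ t, t ^ (j + 1) ∂τ ≤ θ * ∫ t, t ^ j ∂τ := by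
  rw [← integral_const_mul]
  refine integral_mono_ae (integrable_pow_of_measure_compl_Icc_eq_zero τ h (j + 1))
    ((integrable_pow_of_measure_compl_Icc_eq_zero τ h j).const_mul θ) ?_
  have hle : ∀ᵐ t ∂τ, t ≤ θ := by
    filter_upwards [measure_eq_zero_iff_ae_notMem.1 hsupp] with t ht
    simpa using ht
  filter_upwards [ae_mem_Icc_of_measure_compl_Icc_eq_zero τ h, hle] with t ht htθ
  rw [pow_succ, mul_comm]
  exact mul_le_mul_of_nonneg_right htθ (pow_nonneg ht.1 j)

/-- **Chebyshev-type lower bound.**  For a finite measure carried by `[0,1]` and `0 ≤ θ'`,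
`θ'^j · τ[θ', ∞) ≤ ∫ t^j dτ`. [folklore] -/
theorem pow_mul_measureReal_Ici_le_integral_pow (τ : Measure ℝ) [IsFiniteMeasure τ]
    (h : τ (Set.Icc (0 : ℝ) 1)ᶜ = 0) (θ' : ℝ) (hθ' : 0 ≤ θ') (j : ℕ) :
    θ' ^ j * τ.real (Set.Ici θ') ≤ ∫ t, t ^ j ∂τ := by
  have hint := integrable_pow_of_measure_compl_Icc_eq_zero τ h j
  calc θ' ^ j * τ.real (Set.Ici θ') = ∫ _ in Set.Ici θ', θ' ^ j ∂τ := by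
        rw [setIntegral_const, smul_eq_mul, mul_comm]
    _ ≤ ∫ t in Set.Ici θ', t ^ j ∂τ := by
        refine setIntegral_mono_on (integrable_const _).integrableOn hint.integrableOn
          measurableSet_Ici ?_
        intro t ht
        exact pow_le_pow_left₀ hθ' ht j
    _ ≤ ∫ t, t ^ j ∂τ := by
        refine setIntegral_le_integral hint ?_
        filter_upwards [ae_mem_Icc_of_measure_compl_Icc_eq_zero τ h] with t ht
        exact pow_nonneg ht.1 j

/-- **Decay ⇒ support (rigidity).**  If the moments of a finite measure `τ` carried by `[0,1]`
decay like `C θ^j` for SOME constant `C` (`0 ≤ θ`), then `τ` gives no mass to `(θ, ∞)`. [folklore] -/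
theorem measure_Ioi_eq_zero_of_integral_pow_le (τ : Measure ℝ) [IsFiniteMeasure τ]
    (h : τ (Set.Icc (0 : ℝ) 1)ᶜ = 0) (θ C : ℝ) (hθ : 0 ≤ θ)
    (hC : ∀ j : ℕ, ∫ t, t ^ j ∂τ ≤ C * θ ^ j) : τ (Set.Ioi θ) = 0 := by
  -- `(θ, ∞) ⊆ ⋃ₘ [θ + 1/(m+1), ∞)`, so it suffices that every `[θ', ∞)`, `θ' > θ`, is null.
  have hnull : ∀ θ' : ℝ, θ < θ' → τ (Set.Ici θ') = 0 := by
    intro θ' hθθ'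
    by_contra hne
    have hθ'pos : 0 < θ' := lt_of_le_of_lt hθ hθθ'
    have hδ : 0 < τ.real (Set.Ici θ') :=
      lt_of_le_of_ne measureReal_nonneg (Ne.symm ((measureReal_ne_zero_iff).2 hne))
    -- `C (θ/θ')^j → 0`, so eventually `C (θ/θ')^j < τ[θ',∞)`, contradicting the lower bound.
    have hratio : Tendsto (fun j : ℕ => C * (θ / θ') ^ j) atTop (𝓝 (C * 0)) :=
      (tendsto_pow_atTop_nhds_zero_of_lt_one (div_nonneg hθ hθ'pos.le)
        ((div_lt_one hθ'pos).2 hθθ')).const_mul C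
    rw [mul_zero] at hratio
    obtain ⟨j, hj⟩ := (hratio.eventually (gt_mem_nhds hδ)).exists
    have hlow := pow_mul_measureReal_Ici_le_integral_pow τ h θ' hθ'pos.le j
    have hup := hC j
    have hθ'j : 0 < θ' ^ j := pow_pos hθ'pos j
    -- `θ'^j · δ ≤ C θ^j = C (θ/θ')^j θ'^j < δ θ'^j`
    have : C * θ ^ j = C * (θ / θ') ^ j * θ' ^ j := by
      rw [div_pow, mul_assoc, div_mul_cancel₀ _ (ne_of_gt hθ'j)]
    have hlt : C * θ ^ j < θ' ^ j * τ.real (Set.Ici θ') := by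
      rw [this, mul_comm (θ' ^ j)]
      exact mul_lt_mul_of_pos_right hj hθ'j
    linarith
  have hsub : Set.Ioi θ ⊆ ⋃ m : ℕ, Set.Ici (θ + 1 / ((m : ℝ) + 1)) := by
    intro t ht
    obtain ⟨m, hm⟩ := exists_nat_one_div_lt (sub_pos.2 (Set.mem_Ioi.1 ht))
    exact Set.mem_iUnion.2 ⟨m, by simp only [Set.mem_Ici]; linarith⟩
  refine measure_mono_null hsub ((measure_iUnion_null_iff).2 fun m => hnull _ ?_)
  have : (0 : ℝ) < 1 / ((m : ℝ) + 1) := by positivity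
  linarith

/-! ## Hausdorff moment sequences `s (n) = ∫ t^{n-1} dτ`: constant-free ratio bound ⇔ geometric decay ⇔ support -/

/-- **Decay ⇒ gap for a Hausdorff moment sequence.**  If `s (n) = ∫ t^{n-1} dτ` for `n ≥ 1`
(`τ` finite, carried by `[0,1]`) and `s (n) ≤ C θ^n` for `n ≥ 1` with SOME constant `C`
(`0 ≤ θ`), then the constant-free ratio bound `s (n+1) ≤ θ · s (n)` holds for every `n ≥ 1`. [folklore] -/
theorem hausdorffSeq_succ_le_mul_of_le_mul_pow (s : ℕ → ℝ) (τ : Measure ℝ) [IsFiniteMeasure τ]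
    (h : τ (Set.Icc (0 : ℝ) 1)ᶜ = 0) (hs : ∀ n : ℕ, 1 ≤ n → s n = ∫ t, t ^ (n - 1) ∂τ)
    (θ C : ℝ) (hθ : 0 ≤ θ) (hdecay : ∀ n : ℕ, 1 ≤ n → s n ≤ C * θ ^ n) :
    ∀ n : ℕ, 1 ≤ n → s (n + 1) ≤ θ * s n := by
  have hsupp : τ (Set.Ioi θ) = 0 := by
    refine measure_Ioi_eq_zero_of_integral_pow_le τ h θ (C * θ) hθ fun j => ?_
    have := hdecay (j + 1) (Nat.le_add_left 1 j)
    rw [hs (j + 1) (Nat.le_add_left 1 j), Nat.add_sub_cancel] at this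
    simpa [pow_succ, mul_comm, mul_assoc, mul_left_comm] using this
  intro n hn
  rw [hs (n + 1) (Nat.le_add_left 1 n), hs n hn, Nat.add_sub_cancel]
  obtain ⟨m, rfl⟩ := Nat.exists_eq_add_of_le' hn
  rw [Nat.add_sub_cancel]
  exact integral_pow_succ_le_mul_integral_pow_of_measure_Ioi_eq_zero τ h θ hsupp m

/-- **Gap ⇒ decay (elementary converse).**  If `s (n+1) ≤ θ · s (n)` for all `n ≥ 1` (`0 ≤ θ`),
then `s (n) ≤ s 1 · θ^{n-1}` for all `n ≥ 1`. [folklore] -/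
theorem seq_le_mul_pow_of_succ_le_mul (s : ℕ → ℝ) (θ : ℝ) (hθ : 0 ≤ θ)
    (hgap : ∀ n : ℕ, 1 ≤ n → s (n + 1) ≤ θ * s n) :
    ∀ n : ℕ, 1 ≤ n → s n ≤ s 1 * θ ^ (n - 1) := by
  intro n hn
  induction n, hn using Nat.le_induction with
  | base => simp
  | succ m hm ih =>
    calc s (m + 1) ≤ θ * s m := hgap m hm
      _ ≤ θ * (s 1 * θ ^ (m - 1)) := mul_le_mul_of_nonneg_left ih hθ
      _ = s 1 * θ ^ (m + 1 - 1) := by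
        obtain ⟨r, rfl⟩ := Nat.exists_eq_add_of_le' hm
        simp [pow_succ]; ring

/-- **Gap ⇒ support for a Hausdorff moment sequence.**  If `s (n) = ∫ t^{n-1} dτ` for `n ≥ 1` (`τ`
finite, carried by `[0,1]`) and `s (n+1) ≤ θ · s (n)` for all `n ≥ 1` (`0 ≤ θ`), then `τ` gives no
mass to `(θ, ∞)`: the representing measure of a sequence with ratio bound `θ` lives on `[0, θ]`. [folklore] -/
theorem measure_Ioi_eq_zero_of_hausdorffSeq_succ_le_mul (s : ℕ → ℝ) (τ : Measure ℝ)
    [IsFiniteMeasure τ] (h : τ (Set.Icc (0 : ℝ) 1)ᶜ = 0)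
    (hs : ∀ n : ℕ, 1 ≤ n → s n = ∫ t, t ^ (n - 1) ∂τ) (θ : ℝ) (hθ : 0 ≤ θ)
    (hgap : ∀ n : ℕ, 1 ≤ n → s (n + 1) ≤ θ * s n) : τ (Set.Ioi θ) = 0 := by
  refine measure_Ioi_eq_zero_of_integral_pow_le τ h θ (s 1) hθ fun j => ?_
  have hdec := seq_le_mul_pow_of_succ_le_mul s θ hθ hgap (j + 1) (Nat.le_add_left 1 j)
  rwa [hs (j + 1) (Nat.le_add_left 1 j), Nat.add_sub_cancel] at hdec

/-- **Support ⇒ gap for a Hausdorff moment sequence.**  If `s (n) = ∫ t^{n-1} dτ` for `n ≥ 1` with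
`τ` finite, carried by `[0,1]` and giving no mass to `(θ, ∞)`, then `s (n+1) ≤ θ · s (n)` for every
`n ≥ 1`. [folklore] -/
theorem hausdorffSeq_succ_le_mul_of_measure_Ioi_eq_zero (s : ℕ → ℝ) (τ : Measure ℝ)
    [IsFiniteMeasure τ] (h : τ (Set.Icc (0 : ℝ) 1)ᶜ = 0)
    (hs : ∀ n : ℕ, 1 ≤ n → s n = ∫ t, t ^ (n - 1) ∂τ) (θ : ℝ)
    (hsupp : τ (Set.Ioi θ) = 0) : ∀ n : ℕ, 1 ≤ n → s (n + 1) ≤ θ * s n := by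
  intro n hn
  rw [hs (n + 1) (Nat.le_add_left 1 n), hs n hn, Nat.add_sub_cancel]
  obtain ⟨m, rfl⟩ := Nat.exists_eq_add_of_le' hn
  rw [Nat.add_sub_cancel]
  exact integral_pow_succ_le_mul_integral_pow_of_measure_Ioi_eq_zero τ h θ hsupp m

/-- **Hausdorff ⇒ monotone and nonnegative.**  If `s (n) = ∫ t^{n-1} dτ` for `n ≥ 1` (`τ` finite,
carried by `[0,1]`), then `0 ≤ s (n+1) ≤ s (n)` for every `n ≥ 1`. [folklore] -/
theorem hausdorffSeq_succ_le_and_nonneg (s : ℕ → ℝ) (τ : Measure ℝ) [IsFiniteMeasure τ]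
    (h : τ (Set.Icc (0 : ℝ) 1)ᶜ = 0) (hs : ∀ n : ℕ, 1 ≤ n → s n = ∫ t, t ^ (n - 1) ∂τ) :
    ∀ n : ℕ, 1 ≤ n → s (n + 1) ≤ s n ∧ 0 ≤ s (n + 1) := by
  intro n hn
  rw [hs (n + 1) (Nat.le_add_left 1 n), hs n hn, Nat.add_sub_cancel]
  obtain ⟨m, rfl⟩ := Nat.exists_eq_add_of_le' hn
  rw [Nat.add_sub_cancel]
  exact ⟨integral_pow_succ_le_integral_pow τ h m,
    integral_pow_nonneg_of_measure_compl_Icc_eq_zero τ h (m + 1)⟩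

/-! ## Eventual / limsup forms (the bound is needed only for large `j`, and only for rates `θ' > θ`) -/

/-- `(θ, ∞)` is `τ`-null as soon as every `(θ', ∞)`, `θ' > θ`, is. [folklore] -/
theorem measure_Ioi_eq_zero_of_forall_gt (τ : Measure ℝ) (θ : ℝ)
    (h : ∀ θ' : ℝ, θ < θ' → τ (Set.Ioi θ') = 0) : τ (Set.Ioi θ) = 0 := by
  have hsub : Set.Ioi θ ⊆ ⋃ m : ℕ, Set.Ioi (θ + 1 / ((m : ℝ) + 1)) := by
    intro t ht
    obtain ⟨m, hm⟩ := exists_nat_one_div_lt (sub_pos.2 (Set.mem_Ioi.1 ht))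
    exact Set.mem_iUnion.2 ⟨m, by simp only [Set.mem_Ioi]; linarith⟩
  refine measure_mono_null hsub ((measure_iUnion_null_iff).2 fun m => h _ ?_)
  have : (0 : ℝ) < 1 / ((m : ℝ) + 1) := by positivity
  linarith

/-- **Eventual decay ⇒ support.**  If the moments of a finite measure `τ` carried by `[0,1]` satisfy
`∫ t^j dτ ≤ C θ^j` for all LARGE `j` (`0 ≤ θ`, any constant `C`), then `τ (θ, ∞) = 0`. [folklore] -/
theorem measure_Ioi_eq_zero_of_eventually_integral_pow_le (τ : Measure ℝ) [IsFiniteMeasure τ]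
    (h : τ (Set.Icc (0 : ℝ) 1)ᶜ = 0) (θ C : ℝ) (hθ : 0 ≤ θ)
    (hC : ∀ᶠ j : ℕ in atTop, ∫ t, t ^ j ∂τ ≤ C * θ ^ j) : τ (Set.Ioi θ) = 0 := by
  refine measure_Ioi_eq_zero_of_forall_gt τ θ fun θ' hθθ' => ?_
  -- as in `measure_Ioi_eq_zero_of_integral_pow_le`, with `j` taken large
  refine le_antisymm ?_ bot_le
  calc τ (Set.Ioi θ') ≤ τ (Set.Ici θ') := measure_mono Set.Ioi_subset_Ici_self
    _ = 0 := by
      by_contra hne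
      have hθ'pos : 0 < θ' := lt_of_le_of_lt hθ hθθ'
      have hδ : 0 < τ.real (Set.Ici θ') :=
        lt_of_le_of_ne measureReal_nonneg (Ne.symm ((measureReal_ne_zero_iff).2 hne))
      have hratio : Tendsto (fun j : ℕ => C * (θ / θ') ^ j) atTop (𝓝 (C * 0)) :=
        (tendsto_pow_atTop_nhds_zero_of_lt_one (div_nonneg hθ hθ'pos.le)
          ((div_lt_one hθ'pos).2 hθθ')).const_mul C
      rw [mul_zero] at hratio
      obtain ⟨j, hj, hCj⟩ := ((hratio.eventually (gt_mem_nhds hδ)).and hC).exists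
      have hlow := pow_mul_measureReal_Ici_le_integral_pow τ h θ' hθ'pos.le j
      have hθ'j : 0 < θ' ^ j := pow_pos hθ'pos j
      have : C * θ ^ j = C * (θ / θ') ^ j * θ' ^ j := by
        rw [div_pow, mul_assoc, div_mul_cancel₀ _ (ne_of_gt hθ'j)]
      have hlt : C * θ ^ j < θ' ^ j * τ.real (Set.Ici θ') := by
        rw [this, mul_comm (θ' ^ j)]
        exact mul_lt_mul_of_pos_right hj hθ'j
      linarith

/-- **Limsup form of decay ⇒ gap for a Hausdorff moment sequence.**  If `s (n) = ∫ t^{n-1} dτ` for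
`n ≥ 1` (`τ` finite, carried by `[0,1]`), `0 ≤ θ`, and for every rate `θ' > θ` there is a constant
`C` with `s (n) ≤ C θ'^n` for all large `n` (i.e. `limsup s(n)^{1/n} ≤ θ`), then the constant-free
ratio bound `s (n+1) ≤ θ · s (n)` holds for EVERY `n ≥ 1`. [folklore] -/
theorem hausdorffSeq_succ_le_mul_of_forall_gt_eventually_le (s : ℕ → ℝ) (τ : Measure ℝ)
    [IsFiniteMeasure τ] (h : τ (Set.Icc (0 : ℝ) 1)ᶜ = 0)
    (hs : ∀ n : ℕ, 1 ≤ n → s n = ∫ t, t ^ (n - 1) ∂τ) (θ : ℝ) (hθ : 0 ≤ θ)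
    (hdecay : ∀ θ' : ℝ, θ < θ' → ∃ C : ℝ, ∀ᶠ n : ℕ in atTop, s n ≤ C * θ' ^ n) :
    ∀ n : ℕ, 1 ≤ n → s (n + 1) ≤ θ * s n := by
  have hsupp : τ (Set.Ioi θ) = 0 := by
    refine measure_Ioi_eq_zero_of_forall_gt τ θ fun θ' hθθ' => ?_
    obtain ⟨C, hC⟩ := hdecay θ' hθθ'
    refine measure_Ioi_eq_zero_of_eventually_integral_pow_le τ h θ' (C * θ') (hθ.trans hθθ'.le) ?_
    have h1 : ∀ᶠ j : ℕ in atTop, s (j + 1) ≤ C * θ' ^ (j + 1) :=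
      (tendsto_add_atTop_nat 1).eventually hC
    filter_upwards [h1] with j hj
    rw [hs (j + 1) (Nat.le_add_left 1 j), Nat.add_sub_cancel] at hj
    simpa [pow_succ, mul_comm, mul_assoc, mul_left_comm] using hj
  exact hausdorffSeq_succ_le_mul_of_measure_Ioi_eq_zero s τ h hs θ hsupp

/-- A Hausdorff moment sequence `s (n) = ∫ t^{n-1} dτ` (`n ≥ 1`, `τ` finite, carried by `[0,1]`) is
dominated by its first term: `s (n) ≤ s 1` for `n ≥ 1`, and `0 ≤ s 1`. [folklore] -/
theorem hausdorffSeq_le_first (s : ℕ → ℝ) (τ : Measure ℝ) [IsFiniteMeasure τ]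
    (h : τ (Set.Icc (0 : ℝ) 1)ᶜ = 0) (hs : ∀ n : ℕ, 1 ≤ n → s n = ∫ t, t ^ (n - 1) ∂τ) :
    (∀ n : ℕ, 1 ≤ n → s n ≤ s 1) ∧ 0 ≤ s 1 := by
  refine ⟨fun n hn => ?_, ?_⟩
  · have hmono := seq_le_mul_pow_of_succ_le_mul s 1 zero_le_one
      (fun m hm => by simpa using (hausdorffSeq_succ_le_and_nonneg s τ h hs m hm).1) n hn
    simpa using hmono
  · rw [hs 1 le_rfl]
    exact integral_pow_nonneg_of_measure_compl_Icc_eq_zero τ h 0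

/-- **Limsup form, rates in `(θ, 1)` only.**  For a Hausdorff moment sequence the decay hypothesis of
`hausdorffSeq_succ_le_mul_of_forall_gt_eventually_le` is automatic at rates `θ' ≥ 1` (the sequence is
bounded by `s 1`), so it suffices to know `s (n) ≤ C θ'^n` eventually for every `θ' ∈ (θ, 1)`; the
conclusion is again the constant-free ratio bound `s (n+1) ≤ θ · s (n)`, `n ≥ 1`. [folklore] -/
theorem hausdorffSeq_succ_le_mul_of_forall_mem_Ioo_eventually_le (s : ℕ → ℝ) (τ : Measure ℝ)
    [IsFiniteMeasure τ] (h : τ (Set.Icc (0 : ℝ) 1)ᶜ = 0)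
    (hs : ∀ n : ℕ, 1 ≤ n → s n = ∫ t, t ^ (n - 1) ∂τ) (θ : ℝ) (hθ : 0 ≤ θ)
    (hdecay : ∀ θ' : ℝ, θ < θ' → θ' < 1 → ∃ C : ℝ, ∀ᶠ n : ℕ in atTop, s n ≤ C * θ' ^ n) :
    ∀ n : ℕ, 1 ≤ n → s (n + 1) ≤ θ * s n := by
  refine hausdorffSeq_succ_le_mul_of_forall_gt_eventually_le s τ h hs θ hθ fun θ' hθθ' => ?_
  by_cases h1 : θ' < 1
  · exact hdecay θ' hθθ' h1
  · obtain ⟨hle, h0⟩ := hausdorffSeq_le_first s τ h hs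
    refine ⟨s 1, (eventually_ge_atTop 1).mono fun n hn => (hle n hn).trans ?_⟩
    exact le_mul_of_one_le_right h0 (one_le_pow₀ (not_lt.1 h1))

end Literature.MeasureTheory.Moments
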